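import Summits.BirchSwinnertonDyer.Rank1Residual.GaloisImage.EPCWildDevissage
import Summits.BirchSwinnertonDyer.Rank1Residual.GaloisImage.EPCCyclicDescent
import Summits.BirchSwinnertonDyer.Rank1Residual.GaloisImage.EPCBottomLayer
import Summits.BirchSwinnertonDyer.Rank1Residual.GaloisImage.EPCTamePrelim
import Summits.BirchSwinnertonDyer.Rank1Residual.GaloisImage.EPCTameChain
import Literature.NumberTheory.GaloisRepresentations.LocalFieldCdTwo
import HarnessLib

/-!
# Tate's local Euler–Poincaré formula for modules killed by the residue characteristic
# (cell `b2b-bsdres`, team n1011, row T-EPC = Tate's local Euler–Poincaré characteristic; seat p04 GEN 8; stage D6)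

HONEST FRAMING (cell `b2b-bsdres`, run/shared/lean/b2b/bsd-rank1-residual/, verbatim in every
file): the goal of the cell is to DELETE the COMBINATION-SHAPED residual classes of the
Birch–Swinnerton-Dyer formula for ALL analytic-rank `≤ 1` elliptic curves over `ℚ` — "full BSD
formula for every rank `≤ 1` curve in class `C`" assembled STRICTLY from published theorems — so
that the rank-`≤ 1` remainder becomes exactly the CONSTRUCTION-SHAPED classes, which are TYPED
(missing-input `Prop`s), NOT attempted. This is not "finishing BSD". Team n1011 (N10 / N11, the
additive block X4 ∧ `p = 3`): research route; no claim beyond the stated classes; nothing is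
booked; no mark / label is changed by this file. Theorems only (no definition, no named fact, no
`sorry`).  (Placement: Summits/GaloisImage with the T-EPC cone.)

## What

`EPCPrime.localEPC` — **Tate's local Euler–Poincaré characteristic formula
`#H⁰(K, M) · #H²(K, M) · #(𝒪_K / #M 𝒪_K) = #H¹(K, M)` for every finite discrete `Γ_K`-module `M`
killed by the residue characteristic `p` of the non-archimedean local field `K` of characteristic
`0`** (Milne *ADT* I Thm. 2.8, the case `pM = 0`).  Assembly: wild dévissage (stage D3a) to
modules on which `V = ker(M) ∩ ker(μ_p)` and the wild group `J = I_K^{v₁}` act trivially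
(`EPCPrime.localEPC_tame`); for those, the fixed field tower `K ⊂ ⋯ ⊂ K_a` of the `p`-part of
the cyclic quotient `Γ_K / I_K U` (stage D3b chain) descends the count from `Gal(K̄/K_a)`
(stage D5c: the tame layer of stage C5 over the local field `K_a`, `[K_a : K] = p^a`) to `Γ_K`
(stage D4 tower, tree `card_euler_cyclic_step`).

References: J. S. Milne, *Arithmetic Duality Theorems* (2006), I §2 Thm. 2.8 [MilneADT2006];
J.-P. Serre, *Galois Cohomology* (1997), II §5.7 Thm. 5 [SerreGaloisCohomology1997].
-/

noncomputable section

open CategoryTheory Function Field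
open scoped ValuativeRel
open Literature.NumberTheory.GaloisRepresentations
open Literature.NumberTheory.GaloisRepresentations.DiscreteGaloisModule
open Literature.NumberTheory.GaloisRepresentations.LocalWeilDatum

universe u

namespace Summit.BirchSwinnertonDyer.Rank1Residual.GaloisImage

namespace EPCPrime

variable (K : Type u) [Field K] [ValuativeRel K] [TopologicalSpace K] [IsNonarchimedeanLocalField K]
  [CharZero K]
variable {M : Type u} [AddCommGroup M] [TopologicalSpace M] [DiscreteTopology M] [Finite M]

/-- **The tame case.** Let `p` be the residue characteristic, `V ⊴ Γ_K` open normal acting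
trivially on `μ_p`, `J ⊴ Γ_K` with `J V / V` a `p`-group and such that the inertia group has image
of order prime to `p` in `Γ_K / U` for every open normal `U ⊇ J V`.  Then Tate's formula holds
for every finite discrete `M` killed by `p` on which `V` and `J` act trivially.
[cite: MilneADT2006, I §2 Thm 2.8] [cite: SerreGaloisCohomology1997, II §5.7 Thm. 5] -/
theorem localEPC_tame (V J : Subgroup (absoluteGaloisGroup K)) [hVn : V.Normal]
    (hVμ : ∀ g ∈ V, ∀ ζ : MuCarrier K (ringChar 𝓀[K]), mu K (ringChar 𝓀[K]) g ζ = ζ)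
    (hJP : IsPGroup (ringChar 𝓀[K]) (J.map (QuotientGroup.mk' V)))
    (hJtame : ∀ (U : Subgroup (absoluteGaloisGroup K)) [U.Normal], IsOpen (U : Set (absoluteGaloisGroup K)) →
        J ≤ U → V ≤ U →
        (Nat.card ((absInertia K).map (QuotientGroup.mk' U))).Coprime (ringChar 𝓀[K]))
    (ρ : ContinuousRep (absoluteGaloisGroup K) ℤ M) (hpM : ∀ m : M, ringChar 𝓀[K] • m = 0)
    (hVM : ∀ g ∈ V, ∀ m : M, ρ g m = m) (hJM : ∀ g ∈ J, ∀ m : M, ρ g m = m) :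
    Finite (continuousCohomology 1 ρ.toTopRep) ∧ Finite (continuousCohomology 2 ρ.toTopRep) ∧
      Nat.card ρ.toTopRep.ρ.invariants * Nat.card (continuousCohomology 2 ρ.toTopRep) *
          Nat.card (𝒪[K] ⧸ Ideal.span {((Nat.card M : ℕ) : 𝒪[K])}) =
        Nat.card (continuousCohomology 1 ρ.toTopRep) := by
  classical
  set p : ℕ := ringChar 𝓀[K] with hpdef
  haveI hp : Fact p.Prime := ⟨ringChar_residueField_prime (F := K)⟩
  have hpv : ValuativeRel.valuation K p < 1 := EPCTame.valuation_ringChar_lt_one K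
  haveI : CompactSpace (absoluteGaloisGroup K) := absoluteGaloisGroup_compactSpace K
  haveI : Finite (MuCarrier K p) := finite_muCarrier K p
  -- finiteness of `H¹(K, M)`, `H²(K, M)`
  have hf1 : Finite (continuousCohomology 1 ρ.toTopRep) :=
    finite_galoisCohomology_one_of_isNonarchimedeanLocalField ρ
  have hf2 : Finite (continuousCohomology 2 ρ.toTopRep) :=
    (natCard_two_eq_natCard_invariants_homRep K ρ (k := 1) (fun m => by rw [pow_one]; exact hpM m)).1
  refine ⟨hf1, hf2, ?_⟩
  -- `U = ker(M) ∩ ker(μ_p)`, open normal, containing `V` and `J`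
  set U : Subgroup (absoluteGaloisGroup K) := ρ.toRepresentation.ker ⊓ (mu K p).toRepresentation.ker
    with hUdef
  haveI hUn : U.Normal := Subgroup.normal_inf_normal _ _
  have hUo : IsOpen (U : Set (absoluteGaloisGroup K)) :=
    (EPCTame.isOpen_ker ρ).inter (EPCTame.isOpen_ker (mu K p))
  have hmemU : ∀ g, g ∈ U ↔ (∀ m : M, ρ g m = m) ∧ ∀ ζ : MuCarrier K p, mu K p g ζ = ζ := fun g => by
    rw [hUdef, Subgroup.mem_inf, EPCTame.mem_ker_toRepresentation_iff, EPCTame.mem_ker_toRepresentation_iff]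
  have hUM : ∀ g ∈ U, ∀ m : M, ρ g m = m := fun g hg => ((hmemU g).1 hg).1
  have hUμ : ∀ g ∈ U, ∀ ζ : MuCarrier K p, mu K p g ζ = ζ := fun g hg => ((hmemU g).1 hg).2
  have hVU : V ≤ U := fun g hg => (hmemU g).2 ⟨hVM g hg, hVμ g hg⟩
  have hJU : J ≤ U := by
    intro j hj
    refine (hmemU j).2 ⟨hJM j hj, ?_⟩
    -- `j^{p^k} ∈ V` acts trivially on `μ_p`, hence so does `j`
    obtain ⟨k, hk⟩ := hJP ⟨QuotientGroup.mk' V j, Subgroup.mem_map_of_mem _ hj⟩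
    have hk' : j ^ p ^ k ∈ V := by
      have := congrArg Subtype.val hk
      rw [SubmonoidClass.coe_pow, ← map_pow] at this
      exact (QuotientGroup.eq_one_iff _).1 this
    exact EPCTame.mu_eq_self_of_pow K p j (fun ζ => hVμ _ hk' ζ)
  -- `N = I_K U`, `Γ/N` cyclic generated by a Frobenius
  set N : Subgroup (absoluteGaloisGroup K) := absInertia K ⊔ U with hNdef
  haveI hNn : N.Normal := Subgroup.sup_normal _ _
  have hUN : U ≤ N := le_sup_right
  have hNo : IsOpen (N : Set (absoluteGaloisGroup K)) := Subgroup.isOpen_mono hUN hUo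
  haveI : Finite (absoluteGaloisGroup K ⧸ N) := Subgroup.quotient_finite_of_isOpen N hNo
  obtain ⟨φ, hφ⟩ := exists_isFrobPow_holds (F := K) 1
  have hγ : ∀ q : absoluteGaloisGroup K ⧸ N, ∃ i : ℕ, q = (QuotientGroup.mk φ : _ ⧸ N) ^ i :=
    exists_pow_eq_mk K hNo le_sup_left hφ
  obtain ⟨a, Δ, hΔ0, hNΔ, hΔn, hΔle, hΔidx, hΔa, hΔN⟩ := EPCChain.exists_chain N φ hγ hp.out
  have hΔo : ∀ i, IsOpen (Δ i : Set (absoluteGaloisGroup K)) := fun i => Subgroup.isOpen_mono (hNΔ i) hNo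
  -- the fixed field `E` of `Δ a`: Galois of degree `p^a`
  obtain ⟨E, hEfd, hE⟩ := exists_galFixing_eq_of_isOpen (Δ a) (hΔo a)
  haveI := hEfd
  haveI : (galFixing K E).Normal := by rw [hE]; exact hΔn a
  haveI : IsGalois K E := EPCBaseChange.isGalois_of_normal_galFixing K E
  have hdeg : Module.finrank K E = p ^ a := by
    rw [← IsGalois.card_aut_eq_finrank, ← EPCLocalField.index_galFixing K E, hE, hΔa]
  -- `[Δ a : U]` is prime to `p`
  have hidx : ¬ p ∣ U.relIndex (galFixing K E) := by
    rw [hE, ← Subgroup.relIndex_mul_relIndex U N (Δ a) hUN (hNΔ a)]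
    have h1 : ¬ p ∣ U.relIndex N := by
      have hker : U = (QuotientGroup.mk' U).ker := (QuotientGroup.ker_mk' U).symm
      have hcard : U.relIndex N = Nat.card ((absInertia K).map (QuotientGroup.mk' U)) := by
        conv_lhs => rw [hker]
        rw [Subgroup.relIndex_ker, hNdef, Subgroup.map_sup, QuotientGroup.map_mk'_self, sup_bot_eq]
      rw [hcard, ← Nat.Prime.coprime_iff_not_dvd hp.out]
      exact (hJtame U hUo hJU hVU).symm
    intro h
    rcases (Nat.Prime.dvd_mul hp.out).1 h with h' | h'
    · exact h1 h'
    · exact hΔN h'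
  -- bottom layer over `E`, moved to `Δ a`
  have hbottom := EPCBottom.epc_galFixing K p E hpv ρ hpM U hUo hidx hUM hUμ
  rw [hE, hdeg] at hbottom
  obtain ⟨-, -, hbot⟩ := hbottom
  -- the tower
  have hcd : GroupCdLE (absoluteGaloisGroup K) p 2 := groupCdLE_two_absoluteGaloisGroup K p
  haveI : Finite (continuousCohomology 1 (ρ.restrict (subgroupIncl (Δ 0))).toTopRep) := by
    rw [hΔ0]; exact (EPCDescent.finite_restrict_top_iff ρ 1).2 hf1
  haveI : Finite (continuousCohomology 2 (ρ.restrict (subgroupIncl (Δ 0))).toTopRep) := by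
    rw [hΔ0]; exact (EPCDescent.finite_restrict_top_iff ρ 2).2 hf2
  have htower := EPCDescent.epc_tower ρ hp.out hcd hpM Δ a (fun i _ => hΔle i)
    (fun i _ => (hΔn (i + 1)).subgroupOf (Δ i)) hΔidx (fun i _ => hΔo i)
    (Nat.card (𝒪[K] ⧸ Ideal.span {((Nat.card M : ℕ) : 𝒪[K])}))
  obtain ⟨-, -, himp⟩ := htower
  have htop := himp hbot
  rw [hΔ0, EPCDescent.natCard_restrict_top ρ 1, EPCDescent.natCard_restrict_top ρ 2,
    EPCDescent.natCard_invariants_restrict_top ρ] at htop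
  exact htop

/-- **Tate's local Euler–Poincaré characteristic formula for modules killed by the residue
characteristic**: for a non-archimedean local field `K` of characteristic `0` with residue
characteristic `p` and a finite discrete `Γ_K`-module `M` with `pM = 0`, `H¹(K, M)` and
`H²(K, M)` are finite and `#H⁰(K, M) · #H²(K, M) · #(𝒪_K / #M 𝒪_K) = #H¹(K, M)`.
[cite: MilneADT2006, I §2 Thm 2.8] [cite: SerreGaloisCohomology1997, II §5.7 Thm. 5] -/
theorem localEPC (ρ : ContinuousRep (absoluteGaloisGroup K) ℤ M) (hpM : ∀ m : M, ringChar 𝓀[K] • m = 0) :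
    Finite (continuousCohomology 1 ρ.toTopRep) ∧ Finite (continuousCohomology 2 ρ.toTopRep) ∧
      Nat.card ρ.toTopRep.ρ.invariants * Nat.card (continuousCohomology 2 ρ.toTopRep) *
          Nat.card (𝒪[K] ⧸ Ideal.span {((Nat.card M : ℕ) : 𝒪[K])}) =
        Nat.card (continuousCohomology 1 ρ.toTopRep) := by
  classical
  set p : ℕ := ringChar 𝓀[K] with hpdef
  haveI hp : Fact p.Prime := ⟨ringChar_residueField_prime (F := K)⟩
  haveI : CompactSpace (absoluteGaloisGroup K) := absoluteGaloisGroup_compactSpace K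
  haveI : Finite (MuCarrier K p) := finite_muCarrier K p
  -- `V = ker(M) ∩ ker(μ_p)`
  set V : Subgroup (absoluteGaloisGroup K) := ρ.toRepresentation.ker ⊓ (mu K p).toRepresentation.ker
    with hVdef
  haveI hVn : V.Normal := Subgroup.normal_inf_normal _ _
  have hVo : IsOpen (V : Set (absoluteGaloisGroup K)) :=
    (EPCTame.isOpen_ker ρ).inter (EPCTame.isOpen_ker (mu K p))
  have hmemV : ∀ g, g ∈ V ↔ (∀ m : M, ρ g m = m) ∧ ∀ ζ : MuCarrier K p, mu K p g ζ = ζ := fun g => by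
    rw [hVdef, Subgroup.mem_inf, EPCTame.mem_ker_toRepresentation_iff, EPCTame.mem_ker_toRepresentation_iff]
  have hVM : ∀ g ∈ V, ∀ m : M, ρ g m = m := fun g hg => ((hmemV g).1 hg).1
  have hVμ : ∀ g ∈ V, ∀ ζ : MuCarrier K p, mu K p g ζ = ζ := fun g hg => ((hmemV g).1 hg).2
  -- the wild subgroup and the dévissage
  obtain ⟨J, hJn, -, hJP, hJtame⟩ := EPCChain.exists_wild_subgroup K V hVo
  haveI := hJn
  exact EPCDevissage.localEPC_of_forall_trivial K V J hVo hJP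
    (fun τ hpA hVA hJA => localEPC_tame K V J hVμ hJP (fun U _ hUo hJU hVU => hJtame U hUo hJU hVU)
      τ hpA hVA hJA) ρ hpM hVM

end EPCPrime

end Summit.BirchSwinnertonDyer.Rank1Residual.GaloisImage

end
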